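import Summits.CriticalPhenomena.CardyFormulaZ2.Theses.CardyDualCurrent

/-!
# Refutation of `CardyDualCurrent.DualCurrentTemplate` (stmt-CriticalPhenomena-6949)

The window predicate of the route's template,
`W D x i := ∀ e, medialGraph.dist s(0, eᵢ) e ≤ r → Sym2.map (· + x) e ∈ D.innerMedialVertices`,
quantifies over ALL `e : MedialVertex = Sym2 (Site 2)`, including the diagonal pair `s(0, 0)`,
which is no lattice edge, is an ISOLATED vertex of `medialGraph` (every medial dart joins two
`cornerEdge`s, and a `cornerEdge` is never a diagonal pair by a parity count), hence at
`SimpleGraph.dist = 0 ≤ r` from the base vertex (Mathlib's junk value for unreachable pairs),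
while its translate `s(x, x)` is never in `innerMedialVertices ⊆ edgeSet` (loopless). So no
window is ever "interior", the Cauchy–Riemann clauses are vacuous and the non-degeneracy clause
`¬ ∀ D …, ∀ x x' i, W D x i → W D x' i → G D x i = G D x' i` is `¬ True`. Hence the statement is
false as typed — for a junk reason: fix by restricting `e` to genuine medial vertices, e.g.
`∀ e ∈ (zdGraph 2).edgeSet, …`, or by measuring windows with reachability-aware distances. The
same vacuity makes `NoDualCurrentRangeOne`, `NoDualCurrentRangeZero` and
`CanonicalLimitFromExactCR` trivially TRUE as typed (not landed; reported as evidence).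
-/

namespace Summit.CriticalPhenomena.CardyFormulaZ2.Theorems

open Literature.Probability.LatticeModels

/-- **Record of the replaced/dropped route item `DualCurrentTemplate`** = stmt-CriticalPhenomena-6949 (ledger signature verbatim;
NOT a route item): after `CardyDualCurrentDualCurrentTemplate_refuted` below closed the item `refuted` at 136cb0969686, the route
repair (`restate` with a new name, or `drop`) removed this constant from the gate-written Theses
file, while the Theorems file — append-only, statement text fixed — still names it ("Unknown
identifier" in the full builds of 2026-08-16). Re-declared here under its original fully-qualified
name and definiens solely so that this record keeps elaborating. FALSE (see the refutation below). -/
def _root_.Summit.CriticalPhenomena.CardyFormulaZ2.Theses.CardyDualCurrent.DualCurrentTemplate : Prop :=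
  ∃ (r m : ℕ) (z : Fin 2 → Fin m → Literature.Probability.LatticeModels.MedialVertex) (s : Fin 2 → Fin m → ℝ) (g : Fin 2 → Fin m → Set Literature.Probability.LatticeModels.MedialVertex → ℂ), (∀ i k, Literature.Probability.LatticeModels.medialGraph.dist s((0 : Literature.Probability.LatticeModels.Site 2), Pi.single i 1) (z i k) ≤ r) ∧ (let G : Literature.Probability.LatticeModels.DiscreteDobrushin → Literature.Probability.LatticeModels.Site 2 → Fin 2 → ℂ := fun D x i => ∫ cfg, (∑ k, g i k {e | Literature.Probability.LatticeModels.medialGraph.dist s((0 : Literature.Probability.LatticeModels.Site 2), Pi.single i 1) e ≤ r ∧ Sym2.map (· + x) e ∈ cfg} * Literature.Probability.LatticeModels.passageSum (Literature.Probability.LatticeModels.fkInterface D cfg) D.δ (s i k) (Sym2.map (· + x) (z i k))) ∂(Literature.Probability.Percolation.bondPercolation (Literature.Probability.LatticeModels.zdGraph 2) Literature.Probability.Percolation.half); let W : Literature.Probability.LatticeModels.DiscreteDobrushin → Literature.Probability.LatticeModels.Site 2 → Fin 2 → Prop := fun D x i => ∀ e, Literature.Probability.LatticeModels.medialGraph.dist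 s((0 : Literature.Probability.LatticeModels.Site 2), Pi.single i 1) e ≤ r → Sym2.map (· + x) e ∈ D.innerMedialVertices; (∀ D : Literature.Probability.LatticeModels.DiscreteDobrushin, D.IsZdAdmissible → ((Literature.Probability.LatticeModels.discreteDomainGraph D.Ω D.δ).induce D.zdArcA).Preconnected → (∀ x, W D x 0 → W D x 1 → W D (x - Pi.single 0 1) 0 → W D (x - Pi.single 1 1) 1 → G D x 1 - G D (x - Pi.single 1 1) 1 = Complex.I * (G D x 0 - G D (x - Pi.single 0 1) 0)) ∧ (∀ f, W D f 0 → W D (f + Pi.single 1 1) 0 → W D f 1 → W D (f + Pi.single 0 1) 1 → G D (f + Pi.single 1 1) 0 - G D f 0 = Complex.I * (G D (f + Pi.single 0 1) 1 - G D f 1))) ∧ ¬ (∀ D : Literature.Probability.LatticeModels.DiscreteDobrushin, D.IsZdAdmissible → ((Literature.Probability.LatticeModels.discreteDomainGraph D.Ω D.δ).induce D.zdArcA).Preconnected → ∀ x x' i, W D x i → W D x' i → G D x i = G D x' i))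

/-- Refutes `CardyDualCurrent.DualCurrentTemplate` (stmt-CriticalPhenomena-6949): the window
predicate `W D x i` quantifies over all `e : Sym2 (Site 2)`; the diagonal pair `s(0,0)` is an
isolated medial vertex at junk distance `0 ≤ r` from the base vertex `s(0, eᵢ)`, and its
translate `s(x,x)` is never an interior medial vertex (no loops in `discreteDomainGraph`), so
`W D x i` never holds, the Cauchy–Riemann clauses are vacuous and the non-degeneracy clause
`¬ ∀ D …, ∀ x x' i, W D x i → W D x' i → G D x i = G D x' i` fails. Witness: `e = s(0, 0)`.
Fix for the planner: restrict windows to genuine medial vertices (`e ∈ (zdGraph 2).edgeSet`).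
[folklore] -/
theorem CardyDualCurrentDualCurrentTemplate_refuted :
    ¬ Summit.CriticalPhenomena.CardyFormulaZ2.Theses.CardyDualCurrent.DualCurrentTemplate := by
  -- (1) a `cornerEdge` is never a diagonal pair (parity: `2 f i + 1 - v i ≠ v i`)
  have cornerEdge_ne_diag : ∀ (v f : Site 2) (i : Fin 2) (w : Site 2),
      cornerEdge v f i ≠ s(w, w) := by
    intro v f i w h
    have hv : cornerNeighbor v f i = v := by
      unfold cornerEdge at h
      rw [Sym2.eq_iff] at h
      rcases h with ⟨h1, h2⟩ | ⟨h1, h2⟩ <;> exact h2.trans h1.symm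
    have hi := congrFun hv i
    simp only [cornerNeighbor, Function.update_self] at hi
    omega
  -- (2) hence no medial dart starts or ends at a diagonal pair: it is isolated in `medialGraph`
  have not_adj : ∀ (w : Site 2) (e : MedialVertex), ¬ medialGraph.Adj s(w, w) e := by
    intro w e h
    rw [medialGraph_adj_iff] at h
    obtain ⟨-, ⟨v, f, -, hs, -⟩ | ⟨v, f, -, -, ht⟩⟩ := h
    · revert hs
      unfold cornerSource
      split_ifs <;> exact cornerEdge_ne_diag _ _ _ _
    · revert ht
      unfold cornerTarget
      split_ifs <;> exact cornerEdge_ne_diag _ _ _ _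
  have not_reach : ∀ {e : MedialVertex} {w : Site 2}, e ≠ s(w, w) →
      ¬ medialGraph.Reachable e s(w, w) := by
    rintro e w he ⟨p⟩
    cases hp : p.reverse with
    | nil => exact he rfl
    | cons hadj q => exact not_adj w _ hadj
  -- (3) the base vertex `s(0, eᵢ)` is not the diagonal pair, so the junk distance is `0`
  have base_ne : ∀ i : Fin 2,
      (s((0 : Site 2), Pi.single i 1) : MedialVertex) ≠ s((0 : Site 2), (0 : Site 2)) := by
    intro i h
    rw [Sym2.eq_iff] at h
    have h1 : (Pi.single i (1 : ℤ) : Site 2) = 0 := by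
      rcases h with ⟨-, h2⟩ | ⟨-, h2⟩ <;> exact h2
    have := congrFun h1 i
    simp at this
  have dist_zero : ∀ i : Fin 2,
      medialGraph.dist s((0 : Site 2), Pi.single i 1) s((0 : Site 2), (0 : Site 2)) = 0 :=
    fun i => SimpleGraph.dist_eq_zero_of_not_reachable (not_reach (base_ne i))
  -- (4) the translate `s(x, x)` is never an interior medial vertex (no loops)
  have not_inner : ∀ (D : DiscreteDobrushin) (x : Site 2),
      Sym2.map (· + x) s((0 : Site 2), (0 : Site 2)) ∉ D.innerMedialVertices := by
    intro D x h
    rw [Sym2.map_mk, DiscreteDobrushin.mem_innerMedialVertices_iff, SimpleGraph.mem_edgeSet] at h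
    exact h.1.ne rfl
  -- (5) the non-degeneracy clause of any witness is contradicted by the vacuous window predicate
  rintro ⟨r, m, z, s, g, -, hrest⟩
  obtain ⟨-, hnd⟩ := hrest
  apply hnd
  intro D _ _ x x' i hW _
  exfalso
  exact not_inner D x
    (hW s((0 : Site 2), (0 : Site 2)) (by rw [dist_zero]; exact Nat.zero_le _))

end Summit.CriticalPhenomena.CardyFormulaZ2.Theorems
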